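/-
Copyright (c) 2026. Released under the Apache 2.0 license.
-/
import Literature.NumberTheory.EllipticCurves.ManinConstantGamma1ModularDegree
import Literature.NumberTheory.EllipticCurves.CanonicalPAdicHeight
import Literature.NumberTheory.EllipticCurves.GlobalMinimalModel
import HarnessLib

/-!
# Images of the cusps over `∞` under an `X₁(N)`-parametrisation reduce into the IDENTITY COMPONENT at every prime
# (Conrad–Edixhoven–Stein 2003, §6.1.2: the smooth `ℤ`-curve `X_μ(N)` maps to the Néron model; Igusa / Katz–Mazur: its fibres are
# connected; Silverman ATAEC IV.9: identity component of a minimal Weierstrass model = non-singular locus)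

Topic `Literature/NumberTheory/EllipticCurves`; namespace `Literature.NumberTheory.EllipticCurves.ModularForms` (that of
`periodLatticeGamma1`, `cuspSymbol`, `IsNewformOf`; sibling of `Gamma1ParametrizationCuspRationality.lean`).  ONE named fact, statement
only; no definition of data, no theorem.

The sources.  (1) B. Conrad, B. Edixhoven, W. Stein, *`J₁(p)` has connected fibers*, Doc. Math. 8 (2003) 331–408 (bib key
`ConradEdixhovenStein2003`), §6.1.2, proof of Lemma 6.1.6 (p. 381), verbatim: "Let `X_μ(N)` be the coarse moduli scheme over `ℤ` that
classifies isomorphism classes of pairs `(E/S, α)`, with `α : μ_N ↪ E^{sm}` a closed subgroup in the smooth locus of a generalized elliptic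
curve `E` with irreducible geometric fibers `E_s`. This is a smooth `ℤ`-curve that is not proper, and it is readily constructed by combining
the work of Katz-Mazur and Deligne-Rapoport … There is a canonical `ℤ`-point `∞ ∈ X_μ(N)(ℤ)` defined by the standard 1-gon equipped with the
canonical embedding of `μ_N` into the smooth locus `𝔾_m`, and the theory of the Tate curve provides a canonical isomorphism between
`Spf(ℤ[[q]])` and the formal completion of `X_μ(N)` along `∞`. … the formal parameter `q` at the `ℂ`-point `∞` computes the standard analytic
`q`-expansion for weight-2 cusp forms on `Γ₁(N)`. … Let `φ : J₁(N) → A` be the Albanese quotient map over `ℚ`, and pass to Néron models over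
`ℤ` (without changing the notation). Since `X_μ(N)` is `ℤ`-smooth, there is a morphism `X_μ(N) → J₁(N)` over `ℤ` that extends the usual
morphism sending `∞` to `0`."  The cusps of `X_μ(N)` lying over `∞ ∈ X₀(N)` are the `φ(N)/2` points `⟨d⟩∞`, `d ∈ (ℤ/N)ˣ/±1` (the 1-gon
with `μ_N ↪ 𝔾_m` precomposed with the automorphism `ζ ↦ ζ^d` of `μ_N`), and each of them is a `ℤ`-point of `X_μ(N)` for the same reason
as `∞`; analytically `⟨d⟩∞ = γ∞` for `γ = (a b; c d) ∈ Γ₀(N)` (loc. cit. §6.2, p. 386: "its `ℚ`-rational cusps are exactly its cusps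
lying over the cusp `∞ ∈ X₀(p)(ℚ)`"; Diamond–Shurman §7.7–7.9 for the diamond operators).  (2) The fibre of `X_μ(N)` at a prime `p`, `p^k ∥ N`,
is the `μ`-ordinary locus: pairs `(E, α)` with `E` ordinary and `α(μ_{p^k}) = E[p^k]⁰`, i.e. the Igusa curve `Ig(p^k)` over the ordinary
locus of `X_μ(N/p^k)_{𝔽_p}` together with the 1-gon cusps; it is geometrically IRREDUCIBLE, hence connected — J.-I. Igusa, *On the
algebraic theory of elliptic modular functions*, J. Math. Soc. Japan 20 (1968), and N. Katz, B. Mazur, *Arithmetic moduli of elliptic curves*,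
Ann. of Math. Stud. 108 (1985), Thm. 12.6.1 with Cor. 12.6.2 (bib key `KatzMazur1985`; the Igusa covering is totally ramified over every
supersingular point, so its restriction to every connected component of the prime-to-`p` level curve is connected); for `p ∤ N` the fibre
is the smooth proper curve `X₁(N)_{𝔽_p}` minus the cusps not over `∞`, connected as well.  (3) For a globally minimal Weierstrass model of
an elliptic curve `E/ℚ` the identity component of the Néron model over `ℤ_(p)` is the smooth part of the Weierstrass model, so a rational
point reduces into the identity component iff it reduces to a NON-SINGULAR point mod `p` — J. H. Silverman, *Advanced topics in the
arithmetic of elliptic curves*, GTM 151, IV.9, Cor. 9.1 and Thm. 6.1 (bib key `SilvermanATAEC1994`); *AEC* VII.2 (`E₀(ℚ_p)`); and the Néron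
mapping property itself: S. Bosch, W. Lütkebohmert, M. Raynaud, *Néron models*, §1.1 Def. 1 (bib key `BoschLutkebohmertRaynaud1990`).

THE STATEMENT TRANSCRIBED.  Let `E = W/ℚ` be an elliptic curve on a GLOBALLY MINIMAL model with Néron lattice `Λ_E` (`IsNeronLatticeOf`), let
`f ∈ S₂(Γ₀(N))` be its newform (`IsNewformOf W f`), and let `c ≠ 0` be an integer with `c·Λ₁(f) ⊆ Λ_E` (`Λ₁(f) = periodLatticeGamma1 f`, the
periods of `2πi f dz` over `H₁(X₁(N), ℤ)`).  Then `τ ↦ c·2πi∫_{i∞}^τ f (mod Λ_E)` is the analytic germ of a `ℚ`-morphism `π : X_μ(N) → E`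
with `π(∞) = O` (it factors as the optimal quotient `X_μ(N) → J₁(N) → E₁` followed by the `ℚ`-isogeny `E₁ = ℂ/c₁Λ₁(f) → ℂ/Λ_E`,
`z ↦ (c/c₁)z`; cf. `Gamma1ParametrizationData` and the sibling fact `optimalGamma1Parametrization_cusp_rational`), and along `τ → γ∞`,
`γ ∈ Γ₀(N)`, `2πi∫_{i∞}^{γτ} f = {∞, γ∞}_f + 2πi∫_{i∞}^τ f` (`eichlerIntegral_smul_sub`), so `π(γ∞)` is the point of `E` with complex
parameter `c·{∞, γ∞}_f` (`cuspSymbol f γ = {∞, γ∞}_f`).  By (1) and the Néron mapping property, `π` extends to a `ℤ`-morphism from the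
smooth `ℤ`-curve `X_μ(N)` to the Néron model `𝓔` of `E`, carrying the `ℤ`-point `⟨d⟩∞` to a `ℤ`-point of `𝓔`; by (2) the fibre
`X_μ(N)_{𝔽_p}` is connected and contains `∞̄ ↦ Ō`, so its image lies in the identity component `𝓔⁰_{𝔽_p}`; by (3) this says: THE RATIONAL
POINT `π(γ∞)` REDUCES TO A NON-SINGULAR POINT OF `W mod p`, FOR EVERY PRIME `p`.  In the tree's coordinates (the `℘`-uniformisation of
`IsNeronLatticeOf`: `z ↦ (℘_Λ(z) − b₂/12, (℘′_Λ(z) − a₁x − a₃)/2)`, cf. `IsNeronLatticeOf.nonsingular`, `Gamma1ParametrizationData.uniformize_spec`)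
and with the tree's predicate `WeierstrassCurve.HasNonsingularReductionAt` (`CanonicalPAdicHeight.lean`: `ord_p x < 0`, or one of the partial
derivatives `Φ_x`, `Φ_y` of the Weierstrass equation at `(x, y)` is a `p`-adic unit — non-singular reduction on a model integral and minimal
at `p`, AEC VII.2), this is the named fact `gamma1Parametrization_cuspImage_nonsingularReduction` below (for `z = c{∞,γ∞}_f ∉ Λ_E`; when
`z ∈ Λ_E` the point is `O`).

Why this file.  Cell bsd-rank2, line `star` on crux E1M (stmt-BirchSwinnertonDyer-20341): the NODE LAW «the formal Shimura-type rational
2-torsion point of the `X₀(N)`-lattice-optimal curve sits on the node at every bad prime» (Theorems/EisensteinDepletionAtTwoStarOptBSFSigmaNode*,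
lead star-p1 GEN 17) is the case of this fact in which `E` is the 2-isogenous partner `E₀/P` (lattice `2Λ_{E₀} + ℤλ ⊇ c₀Λ₁(f)` by the
Kummer-parity hypothesis) and `π(γ∞)` is the generator of the dual kernel; GEN 17 had sourced the law to the stronger and only
prime-level statement `Φ_p(J₁(N)) = 0` (CES 2003, Thm. 1.1.1).

NOT here: the finer statement that `π(⟨d⟩∞) − π(∞)` generates exactly the image of the `∞`-cuspidal group; the `X₀(N)`-analogue (FALSE in
general: `π₀(0) − π₀(∞)` generates `Φ_p(E₀)` at prime level, Mazur); any statement about cusps not over `∞` (rational only over `ℚ(μ_N)⁺`,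
and reducing to other components).

## References
* [ConradEdixhovenStein2003] B. Conrad, B. Edixhoven, W. Stein, Doc. Math. 8 (2003), §6.1.2, proof of Lemma 6.1.6 (p. 381); §6.2 (p. 386).
* [KatzMazur1985] N. M. Katz, B. Mazur, *Arithmetic moduli of elliptic curves*, Ann. of Math. Stud. 108, Thm. 12.6.1, Cor. 12.6.2 (Igusa's
  irreducibility theorem), §13.4–13.5 (the `(a,b)`-cyclic components of the reduction mod `p`).
* [Igusa1968] J.-I. Igusa, *On the algebraic theory of elliptic modular functions*, J. Math. Soc. Japan 20 (1968) 96–106.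
* [BoschLutkebohmertRaynaud1990] S. Bosch, W. Lütkebohmert, M. Raynaud, *Néron models*, Ergebnisse 21, §1.1 Def. 1, §1.2 Prop. 8.
* [SilvermanATAEC1994] J. H. Silverman, GTM 151, IV.9 Cor. 9.1 (minimal Weierstrass model and `𝓔⁰`), IV.6 Thm. 6.1.
* [SilvermanAEC2009] J. H. Silverman, GTM 106, VII.2 (`E₀(K)`, reduction of points), VI.5 (uniformisation).
* [DiamondShurman2005] F. Diamond, J. Shurman, GTM 228, §7.7–7.9 (`X₁(N)` over `ℚ`, diamond operators, cusps).
-/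

noncomputable section

open scoped MatrixGroups ModularForm

open CongruenceSubgroup WeierstrassCurve

namespace Literature.NumberTheory.EllipticCurves.ModularForms

/-- **Images of the cusps over `∞` under an `X₁(N)`-parametrisation reduce to NON-SINGULAR points modulo every prime** (Conrad–Edixhoven–Stein
2003, §6.1.2, proof of Lemma 6.1.6, p. 381: "`X_μ(N)` … is a smooth `ℤ`-curve … There is a canonical `ℤ`-point `∞ ∈ X_μ(N)(ℤ)` defined by the
standard 1-gon equipped with the canonical embedding of `μ_N` into the smooth locus `𝔾_m` … Since `X_μ(N)` is `ℤ`-smooth, there is a morphism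
`X_μ(N) → J₁(N)` over `ℤ` [Néron models] that extends the usual morphism sending `∞` to `0`" — and likewise for the diamond translates `⟨d⟩∞`,
the cusps over `∞ ∈ X₀(N)`; Katz–Mazur Thm. 12.6.1 / Cor. 12.6.2 (Igusa): the fibre `X_μ(N)_{𝔽_p}` — the `μ`-ordinary Igusa curve with its
1-gon cusps — is connected, so the whole fibre maps into the identity component `𝓔⁰_{𝔽_p}` of the Néron model, the component of `Ō`;
Silverman ATAEC IV.9 Cor. 9.1: for a globally minimal Weierstrass model, `𝓔⁰` is its smooth part, i.e. a rational point reduces into `𝓔⁰`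
iff it reduces to a non-singular point).  Rendering (module docstring): for a globally minimal elliptic `W/ℚ` with newform
`f ∈ S₂(Γ₀(N))`, Néron lattice `L`, an integer `c ≠ 0` with `c·Λ₁(f) ⊆ Λ_E` (so that `τ ↦ c·2πi∫_{i∞}^τ f` is an `X_μ(N)`-parametrisation
of `W` over `ℚ` sending `∞ ↦ O`), and `γ ∈ Γ₀(N)` with `z = c·{∞, γ∞}_f ∉ Λ_E`: the point `π(γ∞) = (℘_Λ(z) − b₂/12, (℘′_Λ(z) − a₁x − a₃)/2)`
has RATIONAL coordinates `(x, y)` and `W.HasNonsingularReductionAt p x y` for every prime `p`.  Named fact (statement only).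
[cite: ConradEdixhovenStein2003, §6.1.2 proof of Lemma 6.1.6 (p. 381) and §6.2 (p. 386)] [cite: KatzMazur1985, Thm. 12.6.1 and Cor. 12.6.2]
[cite: SilvermanATAEC1994, IV.9 Cor. 9.1] [cite: BoschLutkebohmertRaynaud1990, §1.1 Def. 1] -/
def gamma1Parametrization_cuspImage_nonsingularReduction : Prop :=
  ∀ (W : WeierstrassCurve ℚ) [W.IsElliptic] [W.IsGloballyMinimal] ⦃N : ℕ⦄ [NeZero N] (f : CuspForm (Gamma0 N) 2),
    IsNewformOf W f → ∀ (L : PeriodPair), IsNeronLatticeOf (W.baseChange ℂ) L →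
    ∀ (c : ℤ), c ≠ 0 → (∀ z ∈ periodLatticeGamma1 f, (c : ℂ) * z ∈ L.lattice) →
    ∀ (γ : SL(2, ℤ)) (hγ : γ ∈ Gamma0 N), (c : ℂ) * cuspSymbol f ⟨γ, hγ⟩ ∉ L.lattice →
      ∃ x y : ℚ, W.toAffine.Nonsingular x y ∧
        ((x : ℂ) = L.weierstrassP ((c : ℂ) * cuspSymbol f ⟨γ, hγ⟩) - ((W.b₂ : ℚ) : ℂ) / 12) ∧
        ((y : ℂ) = (L.derivWeierstrassP ((c : ℂ) * cuspSymbol f ⟨γ, hγ⟩) - ((W.a₁ : ℚ) : ℂ) * x - ((W.a₃ : ℚ) : ℂ)) / 2) ∧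
        ∀ p : ℕ, p.Prime → W.HasNonsingularReductionAt p x y

-- TODO(general form): the `ℤ`-morphism `X_μ(N) → 𝓔` itself and the statement for an arbitrary `ℚ`-morphism `X₁(N) → E` with `∞ ↦ O`
-- (no Néron models / modular curves over `ℤ` in the tree); the point is `O` when `c{∞,γ∞}_f ∈ Λ_E`.

end Literature.NumberTheory.EllipticCurves.ModularForms

end
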